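import Literature.NumberTheory.Rogawski1990.ArchCentralLimitCornerValueInversion   -- ★ p844106 (F0P3a-p02 (g13)): `Θ^∨ = Θ∘(A ↦ J⁻¹AᴴJ)` — `contDiff_comp_adj`, `hasCompactSupport_comp_adj`, `comp_adj_apply_coe`, `letterDensity_comp_adj_angleChart`
import HarnessLib

/-!
# ROAD «A6-IV» brick (f2), FILE 2 — THE INVERSION SYMMETRY IN JET FORM: the corner-jet value on the `θ₂`-MINIMAL pair (`σ 0 = 2`) gives it on the `θ₂`-MAXIMAL pair (`σ 2 = 2`)
# (Rogawski 1990 §8.4 pp. 126–127; Harish-Chandra [H₂] L. 17.5 — the symmetry `γ ↦ γ⁻¹` of the compact Cartan; jet twin of ★ `cornerValue_max_of_min`)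

Topic `NumberTheory/Rogawski1990`; namespace `Literature.NumberTheory.Rogawski1990`.  THEOREMS ONLY (no `def`, no instance, no notation, no axiom, no named fact, no `sorry`).
Cell `pub/hodgecm-mathlib`, ENGINE T1 (crux H413 = `stmt-HodgeConjecture-24833`); ROAD A, design of record `DESIGN-A6-InHouse-v2-ArchitectureIV` 93542b84 §2 (f2) (owner∕architect F0P3a-p05 (g15),
R-15.10 (1) «(f1)(f2) = p02»); pen F0P3a-p02 (g15), 2026-09-01.  FILE 1 = `ArchCentralLimitChamberValueMin` (the `θ₂`-minimal value from W6-core); FILE 3 = the doubly-noncompact chambers.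

THE SYMMETRY (★ `ArchCentralLimitCornerValueInversion`, re-read for jets instead of corner extensions).  With `Θ^∨(A) := Θ(J⁻¹AᴴJ)` (smooth, compactly supported on `G_w`, `Θ^∨(ζ⁻¹•1) = Θ(ζ•1)`):
`F_{Θ^∨}∘chart_{ζ⁻¹}(θ) = −F_Θ∘chart_ζ(−θ)` (★ `letterDensity_comp_adj_angleChart`), hence (Mathlib `ContinuousLinearEquiv.iteratedFDerivWithin_comp_right` with `x ↦ −x`, `iteratedFDeriv_neg_apply`)
`D³(F_{Θ^∨}∘chart_{ζ⁻¹})(θ) = Ψ(D³(F_Θ∘chart_ζ)(−θ))`, `Ψ(M) := −M∘(−1, −1, −1)` — a continuous (linear) map with `Ψ(M)[v,v,v] = M[v,v,v]`.  So if `D³(F_Θ∘chart_ζ) → J` within a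
`θ₂`-MAXIMAL chamber `C_σ` (`σ 2 = 2`), then `D³(F_{Θ^∨}∘chart_{ζ⁻¹}) → Ψ(J)` within `−C_σ = C_{σ·(0 2)}`, a `θ₂`-MINIMAL chamber, and the hypothesis on the minimal pair gives
`Λ(J) = Λ(Ψ J) = −(c·i)·Θ^∨(ζ⁻¹•1) = −(c·i)·Θ(ζ•1)` — ONE `c` per `ν`.  HEAD **`chamberValue_max_of_min`**: the value clause of ★ (f1) `of_liePhiJetBounds_of_values` on `σ 0 = 2` implies it on
`σ 0 = 2 ∨ σ 2 = 2` (binders VERBATIM FILE 1's conclusion).  With FILE 1: the four compact-adjacent chambers are paid by W6-core.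
HONEST LABEL: HC_CM is proved only modulo the printed citations until rung 0 closes; bookkeeping over ★ files toward paying print row #179, pays nothing by itself.

## References
* [Rogawski1990] J. D. Rogawski, *Automorphic Representations of Unitary Groups in Three Variables*, Ann. of Math. Stud. 123 (1990), §8.4 pp. 126–127.
* [HarishChandra1975HARRG1] Harish-Chandra, *Harmonic analysis on real reductive groups I*, J. Funct. Anal. 19 (1975), §17 Lemma 17.5.
* [PlatonovRapinchuk1994] V. Platonov, A. Rapinchuk, *Algebraic Groups and Number Theory* (1994), §2.3 (`g⁻¹ = J⁻¹gᴴJ` in a unitary group).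
-/

set_option autoImplicit false

noncomputable section

open Filter Topology Set MeasureTheory Measure NumberField NumberField.InfinitePlace Matrix
open Literature.NumberTheory.Automorphic Literature.NumberTheory.Automorphic.UnitaryGroup Literature.Analysis.Calculus
open scoped Matrix MatrixGroups Matrix.Norms.Operator ComplexConjugate ContDiff

namespace Literature.NumberTheory.Rogawski1990

/-! ## §1 Generic: the third jet of `x ↦ −f(−x)` and the map `Ψ(M) = −M∘(−·)` -/

section Reflect

variable {E F : Type*} [NormedAddCommGroup E] [NormedSpace ℝ E] [NormedAddCommGroup F] [NormedSpace ℝ F]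

/-- `Dⁿ[−f(−·)](x) = −(Dⁿf(−x))∘(−1,…,−1)` — composition with the linear isomorphism `x ↦ −x` on the right (no differentiability hypothesis) and a sign. [cite: Rogawski1990, §8.4 p. 126] -/
theorem iteratedFDeriv_neg_comp_neg (f : E → F) (n : ℕ) (x : E) :
    iteratedFDeriv ℝ n (fun y : E => -f (-y)) x =
      -((iteratedFDeriv ℝ n f (-x)).compContinuousLinearMap fun _ => ((ContinuousLinearEquiv.neg ℝ : E ≃L[ℝ] E) : E →L[ℝ] E)) := by
  have h1 : (fun y : E => -f (-y)) = -(f ∘ (ContinuousLinearEquiv.neg ℝ : E ≃L[ℝ] E)) := by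
    funext y
    rfl
  rw [h1, iteratedFDeriv_neg_apply]
  have h2 := (ContinuousLinearEquiv.neg ℝ : E ≃L[ℝ] E).iteratedFDerivWithin_comp_right f uniqueDiffOn_univ (Set.mem_univ _) n (x := x)
  rw [Set.preimage_univ, iteratedFDerivWithin_univ, iteratedFDerivWithin_univ] at h2
  rw [h2]
  rfl

/-- On a diagonal argument `(v,…,v)` of ODD length three the reflection `Ψ(M) = −M∘(−·)` is invisible: `Ψ(M)[v,v,v] = M[v,v,v]`. [cite: Rogawski1990, §8.4 p. 126] -/
theorem neg_compContinuousLinearMap_neg_apply_const_three (M : ContinuousMultilinearMap ℝ (fun _ : Fin 3 => E) F) (v : E) :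
    (-(M.compContinuousLinearMap fun _ => ((ContinuousLinearEquiv.neg ℝ : E ≃L[ℝ] E) : E →L[ℝ] E))) (fun _ : Fin 3 => v) = M (fun _ : Fin 3 => v) := by
  rw [_root_.neg_apply, ContinuousMultilinearMap.compContinuousLinearMap_apply]
  have h : (fun i : Fin 3 => (((ContinuousLinearEquiv.neg ℝ : E ≃L[ℝ] E) : E →L[ℝ] E)) ((fun _ : Fin 3 => v) i)) = fun i : Fin 3 => (-1 : ℝ) • (fun _ : Fin 3 => v) i := by
    funext i
    simp only [ContinuousLinearEquiv.coe_coe, ContinuousLinearEquiv.neg_apply, neg_one_smul]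
  rw [h, ContinuousMultilinearMap.map_smul_univ]
  norm_num [Finset.prod_const, Finset.card_fin]

/-- `Ψ(M) = −M∘(−·)` is continuous in `M`. [cite: Rogawski1990, §8.4 p. 126] -/
theorem continuous_neg_compContinuousLinearMap_neg (n : ℕ) :
    Continuous fun M : ContinuousMultilinearMap ℝ (fun _ : Fin n => E) F =>
      -(M.compContinuousLinearMap fun _ => ((ContinuousLinearEquiv.neg ℝ : E ≃L[ℝ] E) : E →L[ℝ] E)) :=
  (ContinuousMultilinearMap.compContinuousLinearMapL (fun _ : Fin n => ((ContinuousLinearEquiv.neg ℝ : E ≃L[ℝ] E) : E →L[ℝ] E))).continuous.neg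

end Reflect

/-! ## §2 The corner-jet value on the `θ₂`-maximal pair from the `θ₂`-minimal pair -/

section MaxOfMin

variable {L : Type} [Field L] {α : Fin 3 → L} {w : {w : InfinitePlace L // IsComplex w}}

/-- **THE CORNER-JET VALUE ON `σ 2 = 2` FROM `σ 0 = 2`** (inversion symmetry, jet form of ★ `cornerValue_max_of_min`): if for every Haar right-invariant `ν` there is `c > 0` with
`Λ(J) = −(c·i)·Θ(ζ•1)` for every ambient test function `Θ`, every `ζ` and every corner limit `J` of `D³(F_Θ∘chart_ζ)` within a `θ₂`-MINIMAL chamber (`σ 0 = 2`), then the same holds on the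
`θ₂`-MAXIMAL chambers too (`σ 2 = 2`) — apply the hypothesis to `Θ^∨`, `ζ⁻¹`, `σ·(0 2)` and `Ψ(J)`. [cite: Rogawski1990, §8.4 pp. 126–127] [cite: HarishChandra1975HARRG1, §17 Lemma 17.5] -/
theorem chamberValue_max_of_min
    (hDmin :
    ∀ [MeasurableSpace (archLocal L 3 (Matrix.diagonal α) w)] [BorelSpace (archLocal L 3 (Matrix.diagonal α) w)],
      (∀ i, α i ≠ 0) → (∀ i, (w.1.embedding (α i)).im = 0) →
      ∀ (ν : Measure (archLocal L 3 (Matrix.diagonal α) w)) [ν.IsHaarMeasure] [ν.IsMulRightInvariant],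
      ∃ c : ℝ, 0 < c ∧
        ∀ (Θ : Matrix (Fin 3) (Fin 3) ℂ → ℂ), ContDiff ℝ (⊤ : ℕ∞) Θ →
          HasCompactSupport (fun k : archLocal L 3 (Matrix.diagonal α) w => Θ ((k : GL (Fin 3) ℂ) : Matrix (Fin 3) (Fin 3) ℂ)) →
          ∀ (ζ : Circle) (σ : Equiv.Perm (Fin 3)), σ 0 = 2 → ∀ J : ContinuousMultilinearMap ℝ (fun _ : Fin 3 => Fin 3 → ℝ) ℂ,
            Tendsto (iteratedFDeriv ℝ 3 (fun θ : Fin 3 → ℝ => ((((ζ * Circle.exp (θ 0) : Circle) : ℂ)) * (((ζ * Circle.exp (θ 2) : Circle) : ℂ))⁻¹) * ((1 - (((ζ * Circle.exp (θ 1) : Circle) : ℂ)) * (((ζ * Circle.exp (θ 0) : Circle) : ℂ))⁻¹) * (1 - (((ζ * Circle.exp (θ 2) : Circle) : ℂ)) * (((ζ * Circle.exp (θ 1) : Circle) : ℂ))⁻¹) * (1 - (((ζ * Circle.exp (θ 2) : Circle) : ℂ)) * (((ζ * Circle.exp (θ 0) : Circle) : ℂ))⁻¹)) * (∫ g, Θ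 (((g * ⟨circleDiagonal 3 (fun k => ζ * Circle.exp (θ k)), circleDiagonal_mem_archLocal_diagonal L 3 α w _⟩ * g⁻¹ : archLocal L 3 (Matrix.diagonal α) w) : GL (Fin 3) ℂ) : Matrix (Fin 3) (Fin 3) ℂ) ∂ν))) (𝓝[{θ : Fin 3 → ℝ | θ (σ 0) < θ (σ 1) ∧ θ (σ 1) < θ (σ 2)}] 0) (𝓝 J) →
              (1 / 48 : ℂ) * ∑ ε : Fin 3 → Bool, ((((if ε 0 then (1 : ℝ) else -1) * (if ε 1 then (1 : ℝ) else -1) * (if ε 2 then (1 : ℝ) else -1) : ℝ)) : ℂ) * J (fun _ : Fin 3 => ![(if ε 0 then (1 : ℝ) else -1) + (if ε 1 then (1 : ℝ) else -1), -(if ε 0 then (1 : ℝ) else -1) + (if ε 2 then (1 : ℝ) else -1), -(if ε 1 then (1 : ℝ) else -1) - (if ε 2 then (1 : ℝ) else -1)]) =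
                -((c : ℂ) * Complex.I) * Θ ((circleDiagonal 3 (fun _ => ζ) : GL (Fin 3) ℂ) : Matrix (Fin 3) (Fin 3) ℂ)) :
    ∀ [MeasurableSpace (archLocal L 3 (Matrix.diagonal α) w)] [BorelSpace (archLocal L 3 (Matrix.diagonal α) w)],
      (∀ i, α i ≠ 0) → (∀ i, (w.1.embedding (α i)).im = 0) →
      ∀ (ν : Measure (archLocal L 3 (Matrix.diagonal α) w)) [ν.IsHaarMeasure] [ν.IsMulRightInvariant],
      ∃ c : ℝ, 0 < c ∧
        ∀ (Θ : Matrix (Fin 3) (Fin 3) ℂ → ℂ), ContDiff ℝ (⊤ : ℕ∞) Θ →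
          HasCompactSupport (fun k : archLocal L 3 (Matrix.diagonal α) w => Θ ((k : GL (Fin 3) ℂ) : Matrix (Fin 3) (Fin 3) ℂ)) →
          ∀ (ζ : Circle) (σ : Equiv.Perm (Fin 3)), (σ 0 = 2 ∨ σ 2 = 2) → ∀ J : ContinuousMultilinearMap ℝ (fun _ : Fin 3 => Fin 3 → ℝ) ℂ,
            Tendsto (iteratedFDeriv ℝ 3 (fun θ : Fin 3 → ℝ => ((((ζ * Circle.exp (θ 0) : Circle) : ℂ)) * (((ζ * Circle.exp (θ 2) : Circle) : ℂ))⁻¹) * ((1 - (((ζ * Circle.exp (θ 1) : Circle) : ℂ)) * (((ζ * Circle.exp (θ 0) : Circle) : ℂ))⁻¹) * (1 - (((ζ * Circle.exp (θ 2) : Circle) : ℂ)) * (((ζ * Circle.exp (θ 1) : Circle) : ℂ))⁻¹) * (1 - (((ζ * Circle.exp (θ 2) : Circle) : ℂ)) * (((ζ * Circle.exp (θ 0) : Circle) : ℂ))⁻¹)) * (∫ g, Θ (((g * ⟨circleDiagonal 3 (fun k => ζ * Circle.exp (θ k)), circleDiagonal_mem_archLocal_diagonal L 3 α w _⟩ *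 g⁻¹ : archLocal L 3 (Matrix.diagonal α) w) : GL (Fin 3) ℂ) : Matrix (Fin 3) (Fin 3) ℂ) ∂ν))) (𝓝[{θ : Fin 3 → ℝ | θ (σ 0) < θ (σ 1) ∧ θ (σ 1) < θ (σ 2)}] 0) (𝓝 J) →
              (1 / 48 : ℂ) * ∑ ε : Fin 3 → Bool, ((((if ε 0 then (1 : ℝ) else -1) * (if ε 1 then (1 : ℝ) else -1) * (if ε 2 then (1 : ℝ) else -1) : ℝ)) : ℂ) * J (fun _ : Fin 3 => ![(if ε 0 then (1 : ℝ) else -1) + (if ε 1 then (1 : ℝ) else -1), -(if ε 0 then (1 : ℝ) else -1) + (if ε 2 then (1 : ℝ) else -1), -(if ε 1 then (1 : ℝ) else -1) - (if ε 2 then (1 : ℝ) else -1)]) =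
                -((c : ℂ) * Complex.I) * Θ ((circleDiagonal 3 (fun _ => ζ) : GL (Fin 3) ℂ) : Matrix (Fin 3) (Fin 3) ℂ) := by
  intro _ _ hα hreal ν _ _
  obtain ⟨c, hc, hmin⟩ := hDmin hα hreal ν
  refine ⟨c, hc, fun Θ hΘ hΘc ζ σ hσ J hJ => ?_⟩
  rcases hσ with hσ | hσ
  · exact hmin Θ hΘ hΘc ζ σ hσ J hJ
  -- `σ 2 = 2`: reflect through the inversion symmetry
  have hσ' : (σ * Equiv.swap (0 : Fin 3) 2) 0 = 2 := by
    rw [Equiv.Perm.mul_apply, Equiv.swap_apply_left, hσ]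
  have hσ'1 : (σ * Equiv.swap (0 : Fin 3) 2) 1 = σ 1 := by
    rw [Equiv.Perm.mul_apply, Equiv.swap_apply_of_ne_of_ne (by decide) (by decide)]
  have hσ'2 : (σ * Equiv.swap (0 : Fin 3) 2) 2 = σ 0 := by
    rw [Equiv.Perm.mul_apply, Equiv.swap_apply_right]
  -- the reflected letter function is `θ ↦ −F_Θ∘chart_ζ(−θ)`
  have hGF : (fun θ : Fin 3 → ℝ => ((((ζ⁻¹ * Circle.exp (θ 0) : Circle) : ℂ)) * (((ζ⁻¹ * Circle.exp (θ 2) : Circle) : ℂ))⁻¹) * ((1 - (((ζ⁻¹ * Circle.exp (θ 1) : Circle) : ℂ)) * (((ζ⁻¹ * Circle.exp (θ 0) : Circle) : ℂ))⁻¹) * (1 - (((ζ⁻¹ * Circle.exp (θ 2) : Circle) : ℂ)) * (((ζ⁻¹ * Circle.exp (θ 1) : Circle) : ℂ))⁻¹) * (1 - (((ζ⁻¹ * Circle.exp (θ 2) : Circle) : ℂ)) * (((ζ⁻¹ * Circle.exp (θ 0) : Circle) : ℂ))⁻¹)) * (∫ g, Θ (Matrix.diagonal (fun i : Fin 3 =>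 (w.1.embedding (α i))⁻¹) * (((g * ⟨circleDiagonal 3 (fun k => ζ⁻¹ * Circle.exp (θ k)), circleDiagonal_mem_archLocal_diagonal L 3 α w _⟩ * g⁻¹ : archLocal L 3 (Matrix.diagonal α) w) : GL (Fin 3) ℂ) : Matrix (Fin 3) (Fin 3) ℂ)ᴴ * Matrix.diagonal (fun i : Fin 3 => w.1.embedding (α i))) ∂ν)) =
      fun θ : Fin 3 → ℝ => -((fun θ : Fin 3 → ℝ => ((((ζ * Circle.exp (θ 0) : Circle) : ℂ)) * (((ζ * Circle.exp (θ 2) : Circle) : ℂ))⁻¹) * ((1 - (((ζ * Circle.exp (θ 1) : Circle) : ℂ)) * (((ζ * Circle.exp (θ 0) : Circle) : ℂ))⁻¹) * (1 - (((ζ * Circle.exp (θ 2) : Circle) : ℂ)) * (((ζ * Circle.exp (θ 1) : Circle) : ℂ))⁻¹) * (1 - (((ζ * Circle.exp (θ 2) : Circle) : ℂ)) * (((ζ * Circle.exp (θ 0) : Circle) : ℂ))⁻¹)) * (∫ g, Θ (((g * ⟨circleDiagonal 3 (fun k => ζ * Circle.exp (θ k)), circleDiagonal_mem_archLocal_diagonal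 L 3 α w _⟩ * g⁻¹ : archLocal L 3 (Matrix.diagonal α) w) : GL (Fin 3) ℂ) : Matrix (Fin 3) (Fin 3) ℂ) ∂ν)) (-θ)) := by
    funext θ
    exact letterDensity_comp_adj_angleChart L α w hα ν Θ ζ θ
  -- its third jet is `Ψ` of the third jet of `F_Θ∘chart_ζ` at `−θ`
  have hjet : ∀ θ : Fin 3 → ℝ, iteratedFDeriv ℝ 3 (fun θ : Fin 3 → ℝ => ((((ζ⁻¹ * Circle.exp (θ 0) : Circle) : ℂ)) * (((ζ⁻¹ * Circle.exp (θ 2) : Circle) : ℂ))⁻¹) * ((1 - (((ζ⁻¹ * Circle.exp (θ 1) : Circle) : ℂ)) * (((ζ⁻¹ * Circle.exp (θ 0) : Circle) : ℂ))⁻¹) * (1 - (((ζ⁻¹ * Circle.exp (θ 2) : Circle) : ℂ)) * (((ζ⁻¹ * Circle.exp (θ 1) : Circle) : ℂ))⁻¹) * (1 - (((ζ⁻¹ * Circle.exp (θ 2) : Circle) : ℂ)) * (((ζ⁻¹ * Circle.exp (θ 0) : Circle) : ℂ))⁻¹)) * (∫ g, Θ (Matrix.diagonal (fun i : Fin 3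 => (w.1.embedding (α i))⁻¹) * (((g * ⟨circleDiagonal 3 (fun k => ζ⁻¹ * Circle.exp (θ k)), circleDiagonal_mem_archLocal_diagonal L 3 α w _⟩ * g⁻¹ : archLocal L 3 (Matrix.diagonal α) w) : GL (Fin 3) ℂ) : Matrix (Fin 3) (Fin 3) ℂ)ᴴ * Matrix.diagonal (fun i : Fin 3 => w.1.embedding (α i))) ∂ν)) θ =
      -((iteratedFDeriv ℝ 3 (fun θ : Fin 3 → ℝ => ((((ζ * Circle.exp (θ 0) : Circle) : ℂ)) * (((ζ * Circle.exp (θ 2) : Circle) : ℂ))⁻¹) * ((1 - (((ζ * Circle.exp (θ 1) : Circle) : ℂ)) * (((ζ * Circle.exp (θ 0) : Circle) : ℂ))⁻¹) * (1 - (((ζ * Circle.exp (θ 2) : Circle) : ℂ)) * (((ζ * Circle.exp (θ 1) : Circle) : ℂ))⁻¹) * (1 - (((ζ * Circle.exp (θ 2) : Circle) : ℂ)) * (((ζ * Circle.exp (θ 0) : Circle) : ℂ))⁻¹)) * (∫ g, Θ (((g * ⟨circleDiagonal 3 (fun k => ζ * Circle.exp (θ k)), circleDiagonal_mem_archLocal_diagonal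 L 3 α w _⟩ * g⁻¹ : archLocal L 3 (Matrix.diagonal α) w) : GL (Fin 3) ℂ) : Matrix (Fin 3) (Fin 3) ℂ) ∂ν)) (-θ)).compContinuousLinearMap fun _ => ((ContinuousLinearEquiv.neg ℝ : (Fin 3 → ℝ) ≃L[ℝ] (Fin 3 → ℝ)) : (Fin 3 → ℝ) →L[ℝ] (Fin 3 → ℝ))) := by
    intro θ
    rw [hGF]
    exact iteratedFDeriv_neg_comp_neg (fun θ : Fin 3 → ℝ => ((((ζ * Circle.exp (θ 0) : Circle) : ℂ)) * (((ζ * Circle.exp (θ 2) : Circle) : ℂ))⁻¹) * ((1 - (((ζ * Circle.exp (θ 1) : Circle) : ℂ)) * (((ζ * Circle.exp (θ 0) : Circle) : ℂ))⁻¹) * (1 - (((ζ * Circle.exp (θ 2) : Circle) : ℂ)) * (((ζ * Circle.exp (θ 1) : Circle) : ℂ))⁻¹) * (1 - (((ζ * Circle.exp (θ 2) : Circle) : ℂ)) * (((ζ * Circle.exp (θ 0) : Circle) : ℂ))⁻¹)) * (∫ g, Θ (((g * ⟨circleDiagonal 3 (fun k => ζ * Circle.exp (θ k)), circleDiagonal_mem_archLocal_diagonal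 L 3 α w _⟩ * g⁻¹ : archLocal L 3 (Matrix.diagonal α) w) : GL (Fin 3) ℂ) : Matrix (Fin 3) (Fin 3) ℂ) ∂ν)) 3 θ
  -- `−(·)` maps the reflected (θ₂-minimal) chamber into `C_σ` at the corner
  have hneg : Tendsto (fun θ : Fin 3 → ℝ => -θ) (𝓝[{θ : Fin 3 → ℝ | θ ((σ * Equiv.swap (0 : Fin 3) 2) 0) < θ ((σ * Equiv.swap (0 : Fin 3) 2) 1) ∧ θ ((σ * Equiv.swap (0 : Fin 3) 2) 1) < θ ((σ * Equiv.swap (0 : Fin 3) 2) 2)}] 0) (𝓝[{θ : Fin 3 → ℝ | θ (σ 0) < θ (σ 1) ∧ θ (σ 1) < θ (σ 2)}] 0) := by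
    refine tendsto_nhdsWithin_iff.2 ⟨?_, ?_⟩
    · have h := ((continuous_neg (G := Fin 3 → ℝ)).tendsto (0 : Fin 3 → ℝ)).mono_left (nhdsWithin_le_nhds (s := {θ : Fin 3 → ℝ | θ ((σ * Equiv.swap (0 : Fin 3) 2) 0) < θ ((σ * Equiv.swap (0 : Fin 3) 2) 1) ∧ θ ((σ * Equiv.swap (0 : Fin 3) 2) 1) < θ ((σ * Equiv.swap (0 : Fin 3) 2) 2)}))
      rwa [neg_zero] at h
    · filter_upwards [self_mem_nhdsWithin] with θ hθ
      rw [hσ', hσ'1, hσ'2] at hθ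
      show (-θ) (σ 0) < (-θ) (σ 1) ∧ (-θ) (σ 1) < (-θ) (σ 2)
      rw [hσ]
      simp only [Pi.neg_apply]
      exact ⟨neg_lt_neg hθ.2, neg_lt_neg hθ.1⟩
  have hJ' : Tendsto (iteratedFDeriv ℝ 3 (fun θ : Fin 3 → ℝ => ((((ζ⁻¹ * Circle.exp (θ 0) : Circle) : ℂ)) * (((ζ⁻¹ * Circle.exp (θ 2) : Circle) : ℂ))⁻¹) * ((1 - (((ζ⁻¹ * Circle.exp (θ 1) : Circle) : ℂ)) * (((ζ⁻¹ * Circle.exp (θ 0) : Circle) : ℂ))⁻¹) * (1 - (((ζ⁻¹ * Circle.exp (θ 2) : Circle) : ℂ)) * (((ζ⁻¹ * Circle.exp (θ 1) : Circle) : ℂ))⁻¹) * (1 - (((ζ⁻¹ * Circle.exp (θ 2) : Circle) : ℂ)) * (((ζ⁻¹ * Circle.exp (θ 0) : Circle) : ℂ))⁻¹)) * (∫ g, Θ (Matrix.diagonal (fun i : Fin 3 => (w.1.embedding (α i))⁻¹) * (((g * ⟨circleDiagonal 3 (fun k => ζ⁻¹ * Circle.exp (θ k)), circleDiagonal_mem_archLocal_diagonal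 L 3 α w _⟩ * g⁻¹ : archLocal L 3 (Matrix.diagonal α) w) : GL (Fin 3) ℂ) : Matrix (Fin 3) (Fin 3) ℂ)ᴴ * Matrix.diagonal (fun i : Fin 3 => w.1.embedding (α i))) ∂ν))) (𝓝[{θ : Fin 3 → ℝ | θ ((σ * Equiv.swap (0 : Fin 3) 2) 0) < θ ((σ * Equiv.swap (0 : Fin 3) 2) 1) ∧ θ ((σ * Equiv.swap (0 : Fin 3) 2) 1) < θ ((σ * Equiv.swap (0 : Fin 3) 2) 2)}] 0)
      (𝓝 (-(J.compContinuousLinearMap fun _ => ((ContinuousLinearEquiv.neg ℝ : (Fin 3 → ℝ) ≃L[ℝ] (Fin 3 → ℝ)) : (Fin 3 → ℝ) →L[ℝ] (Fin 3 → ℝ))))) := by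
    have h := ((continuous_neg_compContinuousLinearMap_neg (E := Fin 3 → ℝ) (F := ℂ) 3).tendsto J).comp (hJ.comp hneg)
    refine h.congr fun θ => ?_
    simp only [Function.comp_apply]
    exact (hjet θ).symm
  have key := hmin (fun A : Matrix (Fin 3) (Fin 3) ℂ => Θ (Matrix.diagonal (fun i : Fin 3 => (w.1.embedding (α i))⁻¹) * Aᴴ * Matrix.diagonal (fun i : Fin 3 => w.1.embedding (α i)))) (contDiff_comp_adj L α w Θ hΘ)
    (hasCompactSupport_comp_adj L α w hα Θ hΘc) ζ⁻¹ (σ * Equiv.swap (0 : Fin 3) 2) hσ' _ hJ'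
  beta_reduce at key
  -- the centre value `Θ^∨(ζ⁻¹•1) = Θ(ζ•1)`
  have hcen : Θ (Matrix.diagonal (fun i : Fin 3 => (w.1.embedding (α i))⁻¹) * ((circleDiagonal 3 (fun _ : Fin 3 => ζ⁻¹) : GL (Fin 3) ℂ) : Matrix (Fin 3) (Fin 3) ℂ)ᴴ * Matrix.diagonal (fun i : Fin 3 => w.1.embedding (α i))) =
      Θ ((circleDiagonal 3 (fun _ : Fin 3 => ζ) : GL (Fin 3) ℂ) : Matrix (Fin 3) (Fin 3) ℂ) := by
    have h := comp_adj_apply_coe L α w hα Θ (⟨circleDiagonal 3 (fun _ : Fin 3 => ζ⁻¹), circleDiagonal_mem_archLocal_diagonal L 3 α w _⟩ : archLocal L 3 (Matrix.diagonal α) w)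
    rw [Subgroup.coe_inv, ← map_inv] at h
    have hz : (fun _ : Fin 3 => ζ⁻¹)⁻¹ = fun _ : Fin 3 => ζ := by
      funext k
      rw [Pi.inv_apply, inv_inv]
    rw [hz] at h
    exact h
  simp only [neg_compContinuousLinearMap_neg_apply_const_three, hcen] at key
  exact key

end MaxOfMin

end Literature.NumberTheory.Rogawski1990

end
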